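import Mathlib
import Summits.ValiantsHypothesis.ValiantsHypothesis.Theses.DivisionGap
import Literature.Computability.AlgebraicComplexity.MonotoneStructure
import Summits.ValiantsHypothesis.ValiantsHypothesis.Theorems.TriangularDimersDivisionEasy.Negative.EdgeIdeal

/-!
# Disproof of `TriangularDimersDivisionEasy` — findings (standing disprover, gen 1; v3: §E CLOSED and STRENGTHENED — all in tree)

Crux `stmt-ValiantsHypothesis-5067` =
`Summit.ValiantsHypothesis.ValiantsHypothesis.Theses.DivisionGap.TriangularDimersDivisionEasy`
(route DivisionGap, rank 4): `∃ c, ∀ n, ∃ h ≠ 0, L₊(D_n · h) + L₊(h) ≤ 2^((log₂ n + c)^c)`, where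
`D_n ∈ ℝ≥0[x_(v,w)]` is the dimer (perfect-matching) polynomial of the `n × n` rhombus `R_n` of the
triangular lattice in DOUBLED edge variables (`Σ_f Π_v x_(v, f v)` over fixed-point-free adjacent
involutions `f`) and `L₊ = complexity` over the semiring `ℝ≥0` = monotone fan-in-two circuit size
(constants and inputs free).  Informally: "`D_n` has quasi-polynomial subtraction-free complexity
WITH division" (Hrubeš–Yehudayoff normal form `f·h = g`).

## VERDICT of this seat (cycle 1): NO KILL, and none is available by present technique
* A refutation is `∀ c ∃ n ∀ h ≠ 0, L₊(D_n h) + L₊(h) > 2^((log₂ n+c)^c)` — a super-quasi-polynomial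
  lower bound for monotone circuits WITH division computing a MONOTONE polynomial.  No such bound is
  known for ANY monotone polynomial (HrubesYehudayoff2021 §6, Problem 2 / Open Problem 3: "not
  known"; FominGrigorievKoshevoy2014 Rem. 1.5 states the dichotomy for exactly this family as open;
  FGK §8's exponential `{+,×,÷}` bounds are for NON-monotone targets, via positivity of `f·h`, and
  say nothing here; Propp2003 open problem 5 asks for the positive scheme).  The three generic
  monotone engines all die on the factor `h`: (i) support/rectangle arguments see only
  `supp(D_n h) = supp D_n + supp h`; (ii) the Boolean version factors, `B(D_n h) = B(D_n) ∧ B(h)`,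
  and is constant for `h = Π x` (HY21 Rem. 45–46); (iii) Newton-polytope shadows bound formulas only
  (HY21 Thm 42).  (iv) NO FINITE COMPUTATION CAN REFUTE the crux: it is `∃ c ∀ n`, and every finite
  set of `n` is absorbed by a large `c` (each `D_n` has some finite complexity).
* Nothing in the formalisation is junk: `complexity` is the honest fan-in-two gate count
  (`ArithCircuit.lean`), `crux_iff` below is `Iff.rfl`, the six disjuncts are the three edge
  directions both ways (§0), `n` odd and `n = 0` are harmless free layers (§A), and the only side
  condition `h ≠ 0` is exactly what prevents triviality (§A, `trivial_without_h_ne_zero`).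

## WHAT IS LOAD-BEARING (for provers): the division, and nothing else
* WITHOUT DIVISION (`h` forced to be `1`) the statement is FALSE: `L₊(D_n) ≥ 2^{Ω(n)}` — Valiant
  1980 Thm 1 for his triangular region `G_n`; for the rhombus it is now PROVED HERE, sorry-free:
  §E `false_without_division : ¬ (∃ c, ∀ n, L₊(D_n) ≤ 2^((log₂ n + c)^c))` and the exponential form
  `monotone_lower_bound` (`(6^44)^L ≤ 4 L₊(D_n) (n²+1)² (6^44-1)^L` for even `n ≥ 64`, `24L+60 ≤ n`),
  by the ≈ 2500-line development LANDED IN TREE as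
  `Theorems/TriangularDimersDivisionEasy/Negative/{Basic,Matcher,Gadget,Placement,Gluing,Rectangle,
  Peeling,Rows,Gadgets,LowerBound,FalseWithoutDivision}.lean` (namespace
  `…Theorems.TriangularDimersDivisionEasy.Negative`, importable; structure V1–V5 in the §E module doc;
  one computational step: the radius-3 gadget lemma by `native_decide`).  §B is its
  entry point: `D_n` is FULLY ORDERED, so the tree's `ArithCircuit.exists_balanced_decomposition`
  applies verbatim — this is what the doubled-variable encoding buys, and the rectangle structure
  survives the doubling (every mixed edge is used by all or by none of the covers of a product term).
  STRONGER (§E `false_with_unit_h`, `false_unless_h_in_edge_ideal`; in tree as `Negative/UnitH.lean`,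
  `Negative/EdgeIdeal.lean`): the crux is false for EVERY family of denominators with NON-ZERO
  CONSTANT TERM (the degree-`n²` component of `D_n h` is `h(0)·D_n`, and monotone homogenisation is
  built into the structure theorem), and — substituting `1` for the non-edge variables being free
  and fixing `D_n` — for every `h` with a monomial free of EDGE variables: every monomial of a
  successful `h` contains some `x_(v,w)` with `v ∼ w` (`h` lies in the edge ideal; star–mesh pivot
  products and condensation sub-region products do).
  Consequently any proof of the crux must produce an `h` of super-quasi-polynomial MONOTONE
  USEFULNESS: `h = ` monomial is useless (reciprocal inputs gain ≤ quadratically,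
  JuknaSeiwertSergeev2022 Thm 1 / HY21 Prop 43(3)), `h` of degree `2^{o(√n)}`… is useless for
  FORMULAS (Hyafil + shadows), and `h = D_n^k` only helps if `D_n^{k+1}` is itself easy.
  FRONTIER of this seat's method (the next rung, NOT proved): `h = Π_v Σ_{w ∼ v} x_(v,w)` (the
  star–mesh / row-sum shape; `h` lies in the edge ideal).  Then every monomial of `D_n · h` has row
  degree EXACTLY 2 in every row: the product terms of a balanced decomposition are still
  row-homogeneous (no cancellation), but in a row of `a`-degree 1 it is undetermined whether the
  cover edge or the `h`-edge comes from `a` — the rectangle/uniform-status step (V2) has no analogue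
  yet.  A "2-ordered" structure-and-rectangle theorem would refute that rung too; conversely a prover
  looking for a positive scheme should expect denominators of at least this complexity.
* The natural positive mechanism is FALSE AS STATED for this lattice (§C, `decide`d): Kuo's
  two-term subtraction-free condensation `M·M_abcd = M_ab·M_cd + M_ad·M_bc` fails at the corners of
  `R_4` (`56·18 = 1008 ≠ 2048`); what holds is the SIGNED planar-Pfaffian four-point identity
  `M·M_abcd + M_ac·M_bd = M_ab·M_cd + M_ad·M_bc` (`1008 + 1040 = 1024 + 1024`), with the crossing
  term `M_ac·M_bd = 1040` LARGER than either parallel term.  Moreover (toy `toy/tri.py`, exact; kit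
  j008174 re-runs it): among ALL vertex pairs `{p,q}` of `R_4` the only ones with `M(R_4 − p − q) = 0`
  are the two neighbour pairs of the degree-2 corners — so the only subtraction-free four-point
  outer-face condensations of `R_4` are vertex expansions at a corner (no division content).  A
  positive scheme must therefore use identities with ≥ 3 terms per side / larger boundary states
  (cube-recurrence / hexahedron shapes), not Kuo–Propp condensation.
* Numbers: `D_2 = 2`, `D_4 = 56` (§C, `decide`), `D_6 = 56568`, `D_8 = 1848358752` (toy, exact).

## CONTENTS (all `sorry`-free; §E's gadget lemma is `native_decide`, i.e. computational)
* §0 `Adj`, `IsDimer`, `dimers`, `triPM`, `bound`, `crux_iff : crux ↔ ∃ c ∀ n ∃ h ≠ 0, … (Iff.rfl)`.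
* §A `even_of_mem_dimers`, `dimers_eq_empty_of_odd`, `triPM_eq_zero_of_odd`, `clause_of_odd`,
  `triPM_zero`, `clause_zero`, `trivial_without_h_ne_zero`.
* §B `prod_X_eq_monomial`, `dimerExp(_apply/_injective)`, `coeff_triPM` (0/1 coefficients),
  `mem_support_triPM`, `card_support_triPM` (`|supp D_n| = #dimer covers`), `isFullyOrdered_triPM`.
* §C computable matcher `pmCount` on coordinate lists; `pmCount_rhombus_two_four`,
  `fourPoint_data_four`, `pfaffian_fourPoint_at_corners_four`, `not_kuo_twoTerm_at_corners_four`.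
* §E `MonotoneEasyWithoutDivision`, `false_without_division` (PROVED), `monotone_lower_bound`, via the
  tree modules `…Theorems.TriangularDimersDivisionEasy.Negative.*` (imported).
-/

namespace Summit.ValiantsHypothesis.ValiantsHypothesis.Cruxes.TriangularDimersDivisionEasy.Disproof

open Literature.Computability.AlgebraicComplexity
open MvPolynomial
open scoped BigOperators NNReal

set_option linter.dupNamespace false

noncomputable section

/-! ## §0 Unbundling the crux -/

/-- Vertices of the `n × n` rhombus. -/
abbrev Vtx (n : ℕ) : Type := Fin n × Fin n

/-- Variables of the crux's polynomial ring: ordered pairs of vertices (`x_(v, w)`). -/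
abbrev Var (n : ℕ) : Type := Vtx n × Vtx n

/-- Adjacency of the triangular lattice restricted to the rhombus — verbatim the crux's six
disjuncts (edges `(i,j)–(i+1,j)`, `(i,j)–(i,j+1)`, `(i,j)–(i+1,j-1)`, both orientations). -/
def Adj {n : ℕ} (v w : Vtx n) : Prop :=
  ((v.1 : ℕ) + 1 = w.1 ∧ (v.2 : ℕ) = w.2) ∨ ((w.1 : ℕ) + 1 = v.1 ∧ (v.2 : ℕ) = w.2) ∨
  ((v.1 : ℕ) = w.1 ∧ (v.2 : ℕ) + 1 = w.2) ∨ ((v.1 : ℕ) = w.1 ∧ (w.2 : ℕ) + 1 = v.2) ∨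
  ((v.1 : ℕ) + 1 = w.1 ∧ (w.2 : ℕ) + 1 = v.2) ∨ ((w.1 : ℕ) + 1 = v.1 ∧ (v.2 : ℕ) + 1 = w.2)

instance {n : ℕ} (v w : Vtx n) : Decidable (Adj v w) := by unfold Adj; infer_instance

/-- A dimer cover (perfect matching) of the rhombus, encoded as in the crux: a fixed-point-free
involution `f` on the vertices with `v` adjacent to `f v`. -/
def IsDimer {n : ℕ} (f : Vtx n → Vtx n) : Prop := ∀ v, f (f v) = v ∧ f v ≠ v ∧ Adj v (f v)

instance {n : ℕ} (f : Vtx n → Vtx n) : Decidable (IsDimer f) := by unfold IsDimer; infer_instance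

/-- The finite set of dimer covers of `R_n`. -/
def dimers (n : ℕ) : Finset (Vtx n → Vtx n) := Finset.univ.filter IsDimer

/-- The crux's polynomial `D_n = Σ_f Π_v x_(v, f v)` (doubled edge variables). -/
def triPM (n : ℕ) : MvPolynomial (Var n) ℝ≥0 :=
  ∑ f ∈ dimers n, ∏ v : Vtx n, X (v, f v)

/-- The crux's threshold `2 ^ ((log₂ n + c) ^ c)`. -/
def bound (c n : ℕ) : ℕ := 2 ^ ((Nat.log 2 n + c) ^ c)

/-- The crux, unbundled (definitional). -/
theorem crux_iff :
    Theses.DivisionGap.TriangularDimersDivisionEasy ↔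
      ∃ c : ℕ, ∀ n : ℕ, ∃ h : MvPolynomial (Var n) ℝ≥0,
        h ≠ 0 ∧ complexity (triPM n * h) + complexity h ≤ bound c n :=
  Iff.rfl

/-- Constants are free in the tree's circuit model. -/
theorem complexity_C_eq_zero {n : ℕ} (a : ℝ≥0) :
    complexity (C a : MvPolynomial (Var n) ℝ≥0) = 0 :=
  complexity_C_holds (σ := Var n) a

@[simp] theorem complexity_zero_eq {n : ℕ} : complexity (0 : MvPolynomial (Var n) ℝ≥0) = 0 := by
  rw [← C_0]; exact complexity_C_eq_zero (n := n) 0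

@[simp] theorem complexity_one_eq {n : ℕ} : complexity (1 : MvPolynomial (Var n) ℝ≥0) = 0 := by
  rw [← C_1]; exact complexity_C_eq_zero (n := n) 1

/-! ## §A Degenerate layers: odd `n` (and `n = 0`) carry no content -/

/-- A dimer cover is a fixed-point-free involution, so it forces `n` to be even. -/
theorem even_of_mem_dimers {n : ℕ} {f : Vtx n → Vtx n} (hf : f ∈ dimers n) : Even n := by
  classical
  rw [dimers, Finset.mem_filter] at hf
  have hd := hf.2
  have hinv : Function.Involutive f := fun v => (hd v).1
  set σ : Equiv.Perm (Vtx n) := hinv.toPerm f with hσ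
  have hσ2 : σ ^ 2 ^ 1 = 1 := by
    rw [pow_one, sq]
    refine Equiv.ext fun v => ?_
    simp [σ, Equiv.Perm.mul_apply, hinv v]
  by_contra hodd
  have hcard : ¬ 2 ∣ Fintype.card (Vtx n) := by
    rw [Fintype.card_prod, Fintype.card_fin]
    intro h2
    exact hodd ((Nat.even_mul.1 (even_iff_two_dvd.2 h2)).elim id id)
  haveI : Fact (Nat.Prime 2) := ⟨Nat.prime_two⟩
  obtain ⟨a, ha⟩ := Equiv.Perm.exists_fixed_point_of_prime hcard hσ2
  exact (hd a).2.1 (by simpa [σ] using ha)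

/-- For odd `n` there is no dimer cover. -/
theorem dimers_eq_empty_of_odd {n : ℕ} (hn : Odd n) : dimers n = ∅ := by
  ext f
  simp only [Finset.notMem_empty, iff_false]
  intro hf
  exact (Nat.not_even_iff_odd.2 hn) (even_of_mem_dimers hf)

/-- For odd `n` the crux's polynomial is `0`. -/
theorem triPM_eq_zero_of_odd {n : ℕ} (hn : Odd n) : triPM n = 0 := by
  rw [triPM, dimers_eq_empty_of_odd hn, Finset.sum_empty]

/-- Hence at odd `n` the crux's `∃ h`-clause holds for EVERY `c` (witness `h = 1`): the statement
has content only at even `n`. -/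
theorem clause_of_odd {n : ℕ} (hn : Odd n) (c : ℕ) :
    ∃ h : MvPolynomial (Var n) ℝ≥0, h ≠ 0 ∧ complexity (triPM n * h) + complexity h ≤ bound c n := by
  refine ⟨1, one_ne_zero, ?_⟩
  rw [triPM_eq_zero_of_odd hn, zero_mul]
  simp

/-- At `n = 0` the polynomial is `1` (the empty cover), so the clause holds for every `c` too. -/
theorem triPM_zero : triPM 0 = 1 := by
  have h1 : ∀ f : Vtx 0 → Vtx 0,
      (∏ v : Vtx 0, (X (v, f v) : MvPolynomial (Var 0) ℝ≥0)) = 1 := fun f =>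
    Fintype.prod_empty _
  have h2 : dimers 0 = Finset.univ := by
    ext f
    simp only [dimers, Finset.mem_filter, Finset.mem_univ, true_and, iff_true]
    intro v; exact v.1.elim0
  simp only [triPM, h1, h2, Finset.sum_const, Finset.card_univ, nsmul_eq_mul, mul_one]
  norm_num [Fintype.card_fun]

theorem clause_zero (c : ℕ) :
    ∃ h : MvPolynomial (Var 0) ℝ≥0, h ≠ 0 ∧ complexity (triPM 0 * h) + complexity h ≤ bound c 0 := by
  refine ⟨1, one_ne_zero, ?_⟩
  rw [triPM_zero, one_mul]
  simp

/-- HYGIENE: the side condition `h ≠ 0` is what keeps the crux non-trivial — with `h = 0` the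
clause holds for every `n` and `c`. -/
theorem trivial_without_h_ne_zero :
    ∃ c : ℕ, ∀ n : ℕ, ∃ h : MvPolynomial (Var n) ℝ≥0,
      complexity (triPM n * h) + complexity h ≤ bound c n :=
  ⟨0, fun n => ⟨0, by simp⟩⟩

/-! ## §B The polynomial is fully ordered (rows = vertices): the tree's structure theorem applies -/

/-- The dimer monomial of `f` is the monomial with exponent `Σ_v e_(v, f v)`. -/
theorem prod_X_eq_monomial {n : ℕ} (f : Vtx n → Vtx n) :
    (∏ v : Vtx n, (X (v, f v) : MvPolynomial (Var n) ℝ≥0)) =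
      monomial (∑ v : Vtx n, Finsupp.single (v, f v) 1) 1 := by
  rw [monomial_sum_one]
  rfl

/-- Exponent vector of the dimer cover `f`. -/
abbrev dimerExp {n : ℕ} (f : Vtx n → Vtx n) : Var n →₀ ℕ := ∑ v : Vtx n, Finsupp.single (v, f v) 1

theorem dimerExp_apply {n : ℕ} (f : Vtx n → Vtx n) (p : Var n) :
    dimerExp f p = if f p.1 = p.2 then 1 else 0 := by
  classical
  rw [dimerExp, Finsupp.finsetSum_apply, Finset.sum_eq_single p.1]
  · by_cases h : f p.1 = p.2
    · rw [if_pos h, Finsupp.single_apply, if_pos (by rw [h])]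
    · rw [if_neg h, Finsupp.single_apply, if_neg]
      intro hp; exact h (by rw [Prod.ext_iff] at hp; exact hp.2)
  · intro v _ hv
    rw [Finsupp.single_apply, if_neg]
    intro hp; exact hv (by rw [Prod.ext_iff] at hp; exact hp.1)
  · intro h; exact absurd (Finset.mem_univ _) h

theorem dimerExp_injective {n : ℕ} : Function.Injective (dimerExp (n := n)) := by
  intro f g hfg
  funext v
  have h := congrArg (fun e => e (v, f v)) hfg
  simp only [dimerExp_apply] at h
  by_cases hg : g v = f v
  · exact hg.symm
  · rw [if_neg hg] at h; exact absurd h one_ne_zero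

theorem triPM_eq_sum_monomial (n : ℕ) :
    triPM n = ∑ f ∈ dimers n, monomial (dimerExp f) (1 : ℝ≥0) := by
  unfold triPM
  exact Finset.sum_congr rfl fun f _ => prod_X_eq_monomial f

/-- Coefficients of `D_n`: `1` on exponents of dimer covers, `0` elsewhere. -/
theorem coeff_triPM {n : ℕ} (m : Var n →₀ ℕ) :
    coeff m (triPM n) = if ∃ f ∈ dimers n, dimerExp f = m then 1 else 0 := by
  classical
  rw [triPM_eq_sum_monomial, coeff_sum]
  simp only [coeff_monomial]
  rw [Finset.sum_boole]
  split_ifs with h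
  · obtain ⟨f, hf, rfl⟩ := h
    have : (Finset.filter (fun x => dimerExp x = dimerExp f) (dimers n)) = {f} := by
      ext g
      simp only [Finset.mem_filter, Finset.mem_singleton]
      constructor
      · rintro ⟨-, hg⟩; exact dimerExp_injective hg
      · rintro rfl; exact ⟨hf, rfl⟩
    rw [this]; simp
  · have : (Finset.filter (fun x => dimerExp x = m) (dimers n)) = ∅ := by
      ext g
      simp only [Finset.mem_filter, Finset.notMem_empty, iff_false, not_and]
      exact fun hg hgm => h ⟨g, hg, hgm⟩
    rw [this]; simp

theorem mem_support_triPM {n : ℕ} (m : Var n →₀ ℕ) :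
    m ∈ (triPM n).support ↔ ∃ f ∈ dimers n, dimerExp f = m := by
  rw [mem_support_iff, coeff_triPM]
  split_ifs with h <;> simp [h]

/-- The support of `D_n` is in bijection with the dimer covers. -/
theorem card_support_triPM (n : ℕ) : (triPM n).support.card = (dimers n).card := by
  classical
  have : (triPM n).support = (dimers n).image dimerExp := by
    ext m
    rw [mem_support_triPM, Finset.mem_image]
  rw [this, Finset.card_image_of_injective _ dimerExp_injective]

/-- `D_n` is fully ordered in the sense of `MonotoneStructure` (every monomial has degree exactly
one in each row `v`, the row of the variables `x_(v, ·)`): this is what the doubled-variable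
encoding buys — `ArithCircuit.exists_balanced_decomposition` applies to `D_n` verbatim. -/
theorem isFullyOrdered_triPM (n : ℕ) : IsFullyOrdered (triPM n) := by
  classical
  intro m hm i
  obtain ⟨f, -, rfl⟩ := (mem_support_triPM m).1 hm
  rw [dimerExp, rowDegrees, Finsupp.mapDomain_finsetSum]
  simp only [Finsupp.mapDomain_single]
  rw [Finsupp.finsetSum_apply]
  simp [Finsupp.single_apply]

end

/-! ## §C Small models: the natural condensation strengthenings fail at `n = 4`

A computable matcher on explicit coordinate lists (triangular-lattice adjacency on `ℕ × ℕ`, the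
same six disjuncts), evaluated by `decide`. -/

/-- Triangular-lattice adjacency on `ℕ × ℕ` (Boolean form of `Adj`). -/
def adjB (v w : ℕ × ℕ) : Bool :=
  (v.1 + 1 == w.1 && v.2 == w.2) || (w.1 + 1 == v.1 && v.2 == w.2) ||
  (v.1 == w.1 && v.2 + 1 == w.2) || (v.1 == w.1 && w.2 + 1 == v.2) ||
  (v.1 + 1 == w.1 && w.2 + 1 == v.2) || (w.1 + 1 == v.1 && v.2 + 1 == w.2)

/-- Number of perfect matchings of the induced triangular-lattice graph on a duplicate-free vertex
list (match the head with each later neighbour); `fuel` bounds the recursion depth. -/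
def pmCountFuel : ℕ → List (ℕ × ℕ) → ℕ
  | 0, _ => 0
  | _ + 1, [] => 1
  | k + 1, u :: rest => ((rest.filter (adjB u)).map fun w => pmCountFuel k (rest.erase w)).sum

/-- Number of perfect matchings of the induced graph on the listed vertices. -/
def pmCount (l : List (ℕ × ℕ)) : ℕ := pmCountFuel (l.length + 1) l

/-- The vertex list of the rhombus `R_n`. -/
def rhombusList (n : ℕ) : List (ℕ × ℕ) :=
  (List.range n).flatMap fun i => (List.range n).map fun j => (i, j)

/-- `R_4` with the listed vertices deleted. -/
def r4Minus (S : List (ℕ × ℕ)) : List (ℕ × ℕ) := (rhombusList 4).filter fun v => !(S.contains v)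

/-- Sanity: `D_2 = 2`, `D_4 = 56` (kit j008174 also gives `D_6 = 56568`, `D_8 = 1848358752`). -/
theorem pmCount_rhombus_two_four : pmCount (rhombusList 2) = 2 ∧ pmCount (rhombusList 4) = 56 := by
  decide

/-- The eight matching numbers entering the four-point condensation of `R_4` at its corners
`a = (0,0)`, `b = (3,0)`, `c = (3,3)`, `d = (0,3)` (cyclic order on the outer face):
`M = 56`, `M_abcd = 18`, `M_ab = M_cd = M_ad = M_bc = 32`, `M_ac = 52`, `M_bd = 20`. -/
theorem fourPoint_data_four :
    pmCount (r4Minus [(0,0),(3,0),(3,3),(0,3)]) = 18 ∧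
    pmCount (r4Minus [(0,0),(3,0)]) = 32 ∧ pmCount (r4Minus [(3,3),(0,3)]) = 32 ∧
    pmCount (r4Minus [(0,0),(0,3)]) = 32 ∧ pmCount (r4Minus [(3,0),(3,3)]) = 32 ∧
    pmCount (r4Minus [(0,0),(3,3)]) = 52 ∧ pmCount (r4Minus [(3,0),(0,3)]) = 20 := by
  decide

/-- The (signed) planar Pfaffian four-point identity `M·M_abcd + M_ac·M_bd = M_ab·M_cd + M_ad·M_bc`
holds at the corners of `R_4` (`56·18 + 52·20 = 2048 = 32·32 + 32·32`) ... -/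
theorem pfaffian_fourPoint_at_corners_four :
    pmCount (rhombusList 4) * pmCount (r4Minus [(0,0),(3,0),(3,3),(0,3)]) +
      pmCount (r4Minus [(0,0),(3,3)]) * pmCount (r4Minus [(3,0),(0,3)]) =
    pmCount (r4Minus [(0,0),(3,0)]) * pmCount (r4Minus [(3,3),(0,3)]) +
      pmCount (r4Minus [(0,0),(0,3)]) * pmCount (r4Minus [(3,0),(3,3)]) := by
  decide

/-- ... while Kuo's subtraction-free TWO-term condensation (the bipartite mechanism behind the
square-grid companion `SquareGridDimersDivisionEasy`) FAILS for the triangular rhombus: the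
crossing term `M_ac·M_bd = 1040` is non-zero — indeed larger than either parallel term `1024`. -/
theorem not_kuo_twoTerm_at_corners_four :
    pmCount (rhombusList 4) * pmCount (r4Minus [(0,0),(3,0),(3,3),(0,3)]) ≠
    pmCount (r4Minus [(0,0),(3,0)]) * pmCount (r4Minus [(3,3),(0,3)]) +
      pmCount (r4Minus [(0,0),(0,3)]) * pmCount (r4Minus [(3,0),(3,3)]) := by
  decide


/-! ## §E DIVISION IS LOAD-BEARING — Valiant's monotone lower bound (CLOSED, gen 1)

`MonotoneEasyWithoutDivision` is the crux with `h` frozen to `1`.  It is FALSE: `false_without_division`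
below, proved by the development LANDED IN TREE under `Theorems/TriangularDimersDivisionEasy/Negative/`
(namespace `…Theorems.TriangularDimersDivisionEasy.Negative`, abbreviated `LB` in this text; this file
imports `…Negative.EdgeIdeal`).  Structure of the proof (V1–V5; V6–V7 = the strengthenings):
* V1 `LB.isFullyOrdered_triPM` + tree `ArithCircuit.exists_balanced_decomposition`: a size-`s` monotone
  circuit writes `D_n = Σ_t a_t b_t` with `≤ 4 s (n²+1)²` balanced ordered rectangles `a_t b_t ≤ D_n`.
* V2 `LB.rect_uniform`: in the DOUBLED encoding a rectangle may match `x ∈ A` with `y ∉ A`, but uniformly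
  (all covers of the rectangle or none) — swap argument over `ℝ≥0`.
* V3 `LB.exists_gadgets`: a balanced `A` has `≥ (n-60)/24` far-apart mixed lattice edges carrying a valid
  copy of the gadget (rows/columns dichotomy + counting + residues mod 8 + discrete IVT).
* V4 `LB.gadget_pm` (COMPUTATIONAL, `native_decide`, 2^20 boundary subsets): in the radius-3 lattice ball
  around an edge, for EVERY even set `S` of boundary vertices, `ball ∖ S ∖ Q` has a perfect matching,
  `Q` = the unit rhombus through the edge; hence (`LB.exists_two_covers`) the centre edge is never frozen,
  and peeling the gadgets (`LB.peel`, fibres of size `≤ T = 6^44`) gives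
  `T^L |supp(a_t b_t)| ≤ (T-1)^L #covers` (`LB.rect_card_le`).  The radius-1 and radius-2 balls FAIL
  (74 resp. 126 bad boundary subsets — found by the seat's toy search, which also found the r = 3 fact).
* V5 `LB.monotone_lower_bound`: `T^L ≤ 4 L₊(D_n) (n²+1)² (T-1)^L` for even `n ≥ 64`, `24L + 60 ≤ n`;
  `LB.not_monotoneEasyWithoutDivision`: with `n = 2^m`, `L = T k`, `2^k (T-1)^{Tk} ≤ T^{Tk}`, a
  quasi-polynomial bound would give `2^m ≤ 24 T ((m+c)^c + 4m + 6) + 60`, false for `m = 2^t`, `t` large.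
* V6 `LB.not_divisionEasy_with_unit_h` (file `UnitH.lean`): the degree-`n²` component of `D_n · h` is
  `h(0) · D_n`; the structure theorem read for an inhomogeneous output
  (`LB.ArithCircuit.exists_balanced_decomposition_component`) gives Valiant's bound for `L₊(D_n · h)`
  whenever `h(0) ≠ 0` (`LB.monotone_lower_bound_of_coeff_zero_ne_zero`), hence `false_with_unit_h`.
* V7 `LB.not_divisionEasy_unless_edge_ideal` (file `EdgeIdeal.lean`): substituting constants for
  input operands is free (`LB.complexity_subst_le`); `1` for every non-edge variable fixes `D_n` and
  gives `h(0) ≠ 0` whenever `h` has a monomial free of edge variables; hence `false_unless_h_in_edge_ideal`.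
Axioms of `false_without_division` / `false_with_unit_h` / `false_unless_h_in_edge_ideal`: `propext`, `Classical.choice`, `Quot.sound` and the four
`native_decide` certificates `LB.gadget_all₀…₃` (computational).
-/

section NearMiss

/-- The crux with the division removed (`h := 1`): "`D_n` has quasi-polynomial monotone complexity". -/
def MonotoneEasyWithoutDivision : Prop :=
  ∃ c : ℕ, ∀ n : ℕ, complexity (triPM n) ≤ bound c n

/-- The `h = 1` instance of the crux's clause is literally the clause of `MonotoneEasyWithoutDivision`. -/
theorem clause_at_one_iff (c n : ℕ) :
    complexity (triPM n * 1) + complexity (1 : MvPolynomial (Var n) ℝ≥0) ≤ bound c n ↔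
      complexity (triPM n) ≤ bound c n := by
  simp

end NearMiss


/-- **DIVISION IS LOAD-BEARING** (closed, gen 1; in tree): Valiant's exponential monotone lower bound for
the triangular-rhombus dimer polynomial in the tree's encoding — the crux is FALSE once the free factor
`h` is frozen to `1`; any proof of `TriangularDimersDivisionEasy` must exploit `h`
super-quasi-polynomially. [cite: Valiant1980, §3 Thm 1] -/
theorem false_without_division : ¬ MonotoneEasyWithoutDivision :=
  Summit.ValiantsHypothesis.ValiantsHypothesis.Theorems.TriangularDimersDivisionEasy.Negative.not_monotoneEasyWithoutDivision

/-- The exponential form (Valiant 1980 Thm 1, rhombus version): for even `n ≥ 64` and `24 L + 60 ≤ n`,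
`(6^44)^L ≤ 4 · L₊(D_n) · (n²+1)² · (6^44 - 1)^L`. [cite: Valiant1980, §3 Thm 1] -/
theorem monotone_lower_bound {n : ℕ} (h64 : 64 ≤ n) (he : Even n) {L : ℕ} (hL : 24 * L + 60 ≤ n) :
    Summit.ValiantsHypothesis.ValiantsHypothesis.Theorems.TriangularDimersDivisionEasy.Negative.Tfib ^ L ≤
      4 * complexity (triPM n) * (n * n + 1) ^ 2 *
        (Summit.ValiantsHypothesis.ValiantsHypothesis.Theorems.TriangularDimersDivisionEasy.Negative.Tfib - 1) ^ L :=
  Summit.ValiantsHypothesis.ValiantsHypothesis.Theorems.TriangularDimersDivisionEasy.Negative.monotone_lower_bound h64 he hL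

/-- **NO DENOMINATOR WITH NON-ZERO CONSTANT TERM** (in tree, `Negative/UnitH.lean`): the crux's clause
fails for every family `h_n` with `h_n(0) ≠ 0` — the degree-`n²` component of `D_n · h` is `h(0) · D_n`
and Valiant's bound applies to it.  A successful `h` must vanish at the origin. [cite: Valiant1980, §3 Thm 1] -/
theorem false_with_unit_h :
    ¬ ∃ c : ℕ, ∀ n : ℕ, ∃ h : MvPolynomial (Var n) ℝ≥0,
      MvPolynomial.coeff 0 h ≠ 0 ∧ complexity (triPM n * h) + complexity h ≤ bound c n :=
  Summit.ValiantsHypothesis.ValiantsHypothesis.Theorems.TriangularDimersDivisionEasy.Negative.not_divisionEasy_with_unit_h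

/-- **EVERY MONOMIAL OF A SUCCESSFUL DENOMINATOR MEETS AN EDGE** (in tree, `Negative/EdgeIdeal.lean`): the
crux's clause fails for every family `h_n` with a monomial free of edge variables
(`eval (nonEdgePoint n) h_n ≠ 0`, `nonEdgePoint` = edge variables `0`, the others `1`), because
substituting `1` for the non-edge variables is free and fixes `D_n`. [cite: Valiant1980, §3 Thm 1] -/
theorem false_unless_h_in_edge_ideal :
    ¬ ∃ c : ℕ, ∀ n : ℕ, ∃ h : MvPolynomial (Var n) ℝ≥0,
      MvPolynomial.eval (Summit.ValiantsHypothesis.ValiantsHypothesis.Theorems.TriangularDimersDivisionEasy.Negative.nonEdgePoint n) h ≠ 0 ∧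
        complexity (triPM n * h) + complexity h ≤ bound c n :=
  Summit.ValiantsHypothesis.ValiantsHypothesis.Theorems.TriangularDimersDivisionEasy.Negative.not_divisionEasy_unless_edge_ideal

end Summit.ValiantsHypothesis.ValiantsHypothesis.Cruxes.TriangularDimersDivisionEasy.Disproof
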